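import Summits.RiemannHypothesis.RiemannHypothesis.Theorems.HardyZLehmerSplitDictionaryClusterSignsHelpers
import Literature.NumberTheory.LFunctions.SchoenfeldZeroSums
import Mathlib
import HarnessLib

/-!
# Proof of stub_clusterSigns

Window sum bounds under pair-isolation for the Dictionary crux.
-/

noncomputable section

open Complex Set Filter Topology
open Literature.NumberTheory.LFunctions
open StubClusterSignsHelpers

/-- **stub_clusterSigns** — bounds on windowSum at `γ ± δ` under pair-isolation. -/
theorem stub_clusterSigns :
    ∀ γ δ r : ℝ, 100 ≤ γ → 0 < δ → δ < 1 / 2 → 2 * δ ≤ r →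
      riemannZeta (1 / 2 + δ + γ * I) = 0 →
      (∀ s : ℂ, riemannZeta s = 0 → 0 < s.re → s.re < 1 → |s.im - γ| < r →
        s.im = γ ∧ (s.re = 1 / 2 + δ ∨ s.re = 1 / 2 - δ)) →
      1 / δ - 2 * δ
          - ((zetaZeroCount (γ + δ + 1) : ℝ) - zetaZeroCount (γ + δ - 1)) * (1 / (r - δ) + 1 / 2)
          ≤ windowSum (γ + δ) ∧
      windowSum (γ - δ) ≤
        -(1 / δ) + 2 * δ
          + ((zetaZeroCount (γ - δ + 1) : ℝ) - zetaZeroCount (γ - δ - 1)) * (1 / (r - δ) + 1 / 2) := by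
  intro γ δ r hγ hδ hδhalf h2δr hz hiso
  have hγpos : 0 < γ := by linarith
  have hrδ : 0 < r - δ := by linarith
  have hz_partner : riemannZeta (1 / 2 - δ + γ * I) = 0 := partner_zero_exists hδ hδhalf hz
  have hplus_in_wp := pair_plus_mem_window_plus hγpos hδ hδhalf hz
  have hminus_in_wp := pair_minus_mem_window_plus hγpos hδ hδhalf hz_partner
  have hplus_in_wm := pair_plus_mem_window_minus hγpos hδ hδhalf hz
  have hminus_in_wm := pair_minus_mem_window_minus hγpos hδ hδhalf hz_partner
  have hne : (1 / 2 + δ + γ * I : ℂ) ≠ 1 / 2 - δ + γ * I := by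
    intro h; have hre := congrArg Complex.re h; simp at hre; linarith
  have hkp1 := kernel_pair_plus_lower hγ hδ hδhalf
  have hkp2 := kernel_partner_plus_lower hγ hδ hδhalf
  have hkm1 := kernel_pair_plus_minus_upper hγ hδ hδhalf
  have hkm2 := kernel_partner_minus_upper hγ hδ hδhalf
  have hbnd_pos : 0 < 1 / (r - δ) + 1 / 2 := by positivity
  have hwin_p : (window (γ + δ)).Finite := (zetaZeroBox_finite 0 _).subset Set.sdiff_subset
  have hwin_m : (window (γ - δ)).Finite := (zetaZeroBox_finite 0 _).subset Set.sdiff_subset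
  have hord1 : 1 ≤ (riemannZetaZeroOrder (1 / 2 + δ + γ * I) : ℝ) := by
    have := Literature.NumberTheory.DiophantineGeometry.riemannZetaZeroOrder_pos_of_mem_zetaZeroBox
      (Set.mem_of_mem_sdiff hplus_in_wp); exact_mod_cast this
  have hord2 : 1 ≤ (riemannZetaZeroOrder (1 / 2 - δ + γ * I) : ℝ) := by
    have := Literature.NumberTheory.DiophantineGeometry.riemannZetaZeroOrder_pos_of_mem_zetaZeroBox
      (Set.mem_of_mem_sdiff hminus_in_wp); exact_mod_cast this
  have hker_pos : 0 < 1 / (2 * δ) - δ := by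
    have hpos : 0 < 2 * δ := by linarith
    rw [show 1 / (2 * δ) - δ = (1 - 2 * δ * δ) / (2 * δ) by field_simp]
    apply div_pos _ hpos; nlinarith
  let shift := 1 / (r - δ) + 1 / 2
  have hshift_pos : 0 < shift := hbnd_pos
  constructor
  · -- Lower bound on windowSum (γ + δ)
    unfold windowSum
    have hpair_lb : (riemannZetaZeroOrder (1 / 2 + δ + γ * I) : ℝ) * kernel (γ + δ) (1 / 2 + δ + γ * I) +
        (riemannZetaZeroOrder (1 / 2 - δ + γ * I) : ℝ) * kernel (γ + δ) (1 / 2 - δ + γ * I) ≥ 1 / δ - 2 * δ := by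
      have h1 : (riemannZetaZeroOrder (1 / 2 + δ + γ * I) : ℝ) * kernel (γ + δ) (1 / 2 + δ + γ * I) ≥ 1 / (2 * δ) - δ := by
        calc _ ≥ 1 * kernel (γ + δ) (1 / 2 + δ + γ * I) := mul_le_mul_of_nonneg_right hord1 (by linarith)
          _ = kernel (γ + δ) (1 / 2 + δ + γ * I) := one_mul _
          _ ≥ 1 / (2 * δ) - δ := hkp1
      have h2 : (riemannZetaZeroOrder (1 / 2 - δ + γ * I) : ℝ) * kernel (γ + δ) (1 / 2 - δ + γ * I) ≥ 1 / (2 * δ) - δ := by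
        calc _ ≥ 1 * kernel (γ + δ) (1 / 2 - δ + γ * I) := mul_le_mul_of_nonneg_right hord2 (by linarith)
          _ = kernel (γ + δ) (1 / 2 - δ + γ * I) := one_mul _
          _ ≥ 1 / (2 * δ) - δ := hkp2
      calc 1 / δ - 2 * δ = (1 / (2 * δ) - δ) + (1 / (2 * δ) - δ) := by field_simp; ring
        _ ≤ _ := add_le_add h1 h2
    have h_weaker : 1 / δ - 2 * δ - (↑(zetaZeroCount (γ + δ + 1)) - ↑(zetaZeroCount (γ + δ - 1))) * shift ≤
        (riemannZetaZeroOrder (1 / 2 + δ + γ * I) : ℝ) * kernel (γ + δ) (1 / 2 + δ + γ * I) +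
        (riemannZetaZeroOrder (1 / 2 - δ + γ * I) : ℝ) * kernel (γ + δ) (1 / 2 - δ + γ * I) -
        ((zetaZeroCount (γ + δ + 1) : ℝ) - zetaZeroCount (γ + δ - 1) - 2) * shift := by nlinarith [hpair_lb, hshift_pos]
    calc 1 / δ - 2 * δ - (↑(zetaZeroCount (γ + δ + 1)) - ↑(zetaZeroCount (γ + δ - 1))) * (1 / (r - δ) + 1 / 2)
        ≤ (riemannZetaZeroOrder (1 / 2 + δ + γ * I) : ℝ) * kernel (γ + δ) (1 / 2 + δ + γ * I) +
          (riemannZetaZeroOrder (1 / 2 - δ + γ * I) : ℝ) * kernel (γ + δ) (1 / 2 - δ + γ * I) -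
          ((zetaZeroCount (γ + δ + 1) : ℝ) - zetaZeroCount (γ + δ - 1) - 2) * shift := h_weaker
      _ ≤ ∑ᶠ ρ ∈ window (γ + δ), (riemannZetaZeroOrder ρ : ℝ) * kernel (γ + δ) ρ := by
        let ρ₁ : ℂ := 1 / 2 + δ + γ * I; let ρ₂ : ℂ := 1 / 2 - δ + γ * I
        let f : ℂ → ℝ := fun ρ => (riemannZetaZeroOrder ρ : ℝ) * kernel (γ + δ) ρ
        rw [finsum_mem_eq_finite_toFinset_sum f hwin_p]; let S := hwin_p.toFinset
        have h₁S : ρ₁ ∈ S := by rw [Set.Finite.mem_toFinset]; exact hplus_in_wp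
        have h₂S : ρ₂ ∈ S := by rw [Set.Finite.mem_toFinset]; exact hminus_in_wp
        have h₂S' : ρ₂ ∈ S.erase ρ₁ := Finset.mem_erase.mpr ⟨hne.symm, h₂S⟩
        have h_split : (S.erase ρ₁).sum f + f ρ₁ = S.sum f := Finset.sum_erase_add S f h₁S
        have h_split2 : ((S.erase ρ₁).erase ρ₂).sum f + f ρ₂ = (S.erase ρ₁).sum f := Finset.sum_erase_add (S.erase ρ₁) f h₂S'
        have h_full_split : S.sum f = f ρ₁ + f ρ₂ + ((S.erase ρ₁).erase ρ₂).sum f := by rw [← h_split, ← h_split2]; ring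
        let rest := (S.erase ρ₁).erase ρ₂; rw [h_full_split]
        have h_rest_lb : rest.sum f ≥ -(((zetaZeroCount (γ + δ + 1) : ℝ) - zetaZeroCount (γ + δ - 1)) - 2) * shift := by
          have hS_eq : S = SchoenfeldBound.zerosBetween (γ + δ - 1) (γ + δ + 1) := by
            ext ρ; rw [Set.Finite.mem_toFinset]
            simp only [SchoenfeldBound.zerosBetween, Set.Finite.mem_toFinset, window, Set.mem_sdiff]
          have hW_eq : (zetaZeroCount (γ + δ + 1) : ℝ) - zetaZeroCount (γ + δ - 1) = S.sum (fun ρ => (riemannZetaZeroOrder ρ : ℝ)) := by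
            rw [SchoenfeldBound.zetaZeroCount_sub_eq_sum (by linarith : γ + δ - 1 ≤ γ + δ + 1), ← hS_eq]
          have hterm_bound : ∀ ρ ∈ rest, f ρ ≥ -(riemannZetaZeroOrder ρ : ℝ) * shift := by
            intro ρ hρ
            have hρ_ne1 : ρ ≠ ρ₁ := Finset.ne_of_mem_erase (Finset.mem_erase.mp hρ).2
            have hρ_ne2 : ρ ≠ ρ₂ := fun h => (Finset.mem_erase.mp hρ).1 h
            have hρ_in_win : ρ ∈ window (γ + δ) := by
              have h3 : ρ ∈ S := Finset.mem_of_mem_erase (Finset.mem_of_mem_erase hρ)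
              rw [Set.Finite.mem_toFinset] at h3; exact h3
            simp only [window, Set.mem_sdiff, Set.mem_setOf_eq, zetaZeroBox] at hρ_in_win
            have hρ_zero := hρ_in_win.1.1; have hρ_im_pos : 0 < ρ.im := hρ_in_win.1.2.2.2.1
            have hρ_re0 := Literature.NumberTheory.DiophantineGeometry.re_pos_of_riemannZeta_eq_zero hρ_zero hρ_im_pos.ne'
            have hρ_re1 := Literature.NumberTheory.DiophantineGeometry.re_lt_one_of_riemannZeta_eq_zero hρ_zero
            have hρ_iso : r ≤ |ρ.im - γ| := by
              by_contra h; push Not at h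
              have hpair := hiso ρ hρ_zero hρ_re0 hρ_re1 h
              cases hpair.2 with
              | inl hre => exact hρ_ne1 (Complex.ext (by simp only [ρ₁, Complex.add_re, Complex.ofReal_re, Complex.mul_re, Complex.I_re, mul_zero, Complex.I_im, mul_one, hre]; norm_num) (by simp only [ρ₁, Complex.add_im, Complex.ofReal_im, Complex.mul_im, Complex.I_re, Complex.I_im, zero_mul, mul_one, add_zero, hpair.1]; norm_num))
              | inr hre => exact hρ_ne2 (Complex.ext (by simp only [ρ₂, Complex.sub_re, Complex.add_re, Complex.ofReal_re, Complex.mul_re, Complex.I_re, mul_zero, Complex.I_im, mul_one, hre]; norm_num) (by simp only [ρ₂, Complex.sub_im, Complex.add_im, Complex.ofReal_im, Complex.mul_im, Complex.I_re, Complex.I_im, zero_mul, mul_one, add_zero, hpair.1]; norm_num))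
            have ht_dist : |(γ + δ) - γ| ≤ δ := by simp [abs_of_pos hδ]
            have hker_bnd := abs_kernel_nonpair_le hδ h2δr hρ_iso hρ_re0 hρ_re1 ht_dist
            have hK_ge : kernel (γ + δ) ρ ≥ -shift := by
              have h1 : -|kernel (γ + δ) ρ| ≤ kernel (γ + δ) ρ := neg_abs_le _
              have h2 : -shift ≤ -|kernel (γ + δ) ρ| := neg_le_neg hker_bnd
              linarith
            have hm_nonneg : 0 ≤ (riemannZetaZeroOrder ρ : ℝ) := by exact_mod_cast riemannZetaZeroOrder_nonneg_of_zero hρ_zero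
            calc f ρ = (riemannZetaZeroOrder ρ : ℝ) * kernel (γ + δ) ρ := rfl
              _ ≥ (riemannZetaZeroOrder ρ : ℝ) * (-shift) := mul_le_mul_of_nonneg_left hK_ge hm_nonneg
              _ = -(riemannZetaZeroOrder ρ : ℝ) * shift := by ring
          have h_sum_neg : rest.sum f ≥ rest.sum (fun ρ => -(riemannZetaZeroOrder ρ : ℝ) * shift) := Finset.sum_le_sum (fun ρ hρ => hterm_bound ρ hρ)
          have h_factor : rest.sum (fun ρ => -(riemannZetaZeroOrder ρ : ℝ) * shift) = -shift * rest.sum (fun ρ => (riemannZetaZeroOrder ρ : ℝ)) := by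
            have : ∀ ρ, -(riemannZetaZeroOrder ρ : ℝ) * shift = -shift * (riemannZetaZeroOrder ρ : ℝ) := by intro ρ; ring
            simp only [this, ← Finset.mul_sum]
          let m : ℂ → ℝ := fun ρ => (riemannZetaZeroOrder ρ : ℝ)
          have herase1 : m ρ₁ + (S.erase ρ₁).sum m = S.sum m := Finset.add_sum_erase S m h₁S
          have herase2 : m ρ₂ + rest.sum m = (S.erase ρ₁).sum m := Finset.add_sum_erase (S.erase ρ₁) m h₂S'
          have hrest_mult_le : rest.sum m ≤ (zetaZeroCount (γ + δ + 1) : ℝ) - zetaZeroCount (γ + δ - 1) - 2 := by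
            calc rest.sum m = S.sum m - m ρ₁ - m ρ₂ := by linarith [herase1, herase2]
              _ = (zetaZeroCount (γ + δ + 1) : ℝ) - zetaZeroCount (γ + δ - 1) - m ρ₁ - m ρ₂ := by rw [← hW_eq]
              _ ≤ _ := by simp only [m]; linarith [hord1, hord2]
          calc rest.sum f ≥ rest.sum (fun ρ => -(riemannZetaZeroOrder ρ : ℝ) * shift) := h_sum_neg
            _ = -shift * rest.sum m := h_factor
            _ ≥ -shift * ((zetaZeroCount (γ + δ + 1) : ℝ) - zetaZeroCount (γ + δ - 1) - 2) := by apply mul_le_mul_of_nonpos_left hrest_mult_le; linarith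
            _ = -(((zetaZeroCount (γ + δ + 1) : ℝ) - zetaZeroCount (γ + δ - 1)) - 2) * shift := by ring
        linarith [h_rest_lb]
  · -- Upper bound on windowSum (γ - δ)
    unfold windowSum
    let ρ₁ : ℂ := 1 / 2 + δ + γ * I; let ρ₂ : ℂ := 1 / 2 - δ + γ * I
    let f : ℂ → ℝ := fun ρ => (riemannZetaZeroOrder ρ : ℝ) * kernel (γ - δ) ρ
    have hpair_ub : f ρ₁ + f ρ₂ ≤ -(1 / δ) + 2 * δ := by
      have h1 : f ρ₁ ≤ -(1 / (2 * δ)) + δ := by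
        calc f ρ₁ = (riemannZetaZeroOrder ρ₁ : ℝ) * kernel (γ - δ) ρ₁ := rfl
          _ ≤ 1 * kernel (γ - δ) ρ₁ := mul_le_mul_of_nonpos_right hord1 (by linarith)
          _ = kernel (γ - δ) ρ₁ := one_mul _
          _ ≤ -(1 / (2 * δ)) + δ := hkm1
      have h2 : f ρ₂ ≤ -(1 / (2 * δ)) + δ := by
        calc f ρ₂ = (riemannZetaZeroOrder ρ₂ : ℝ) * kernel (γ - δ) ρ₂ := rfl
          _ ≤ 1 * kernel (γ - δ) ρ₂ := mul_le_mul_of_nonpos_right hord2 (by linarith)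
          _ = kernel (γ - δ) ρ₂ := one_mul _
          _ ≤ -(1 / (2 * δ)) + δ := hkm2
      calc f ρ₁ + f ρ₂ ≤ (-(1 / (2 * δ)) + δ) + (-(1 / (2 * δ)) + δ) := add_le_add h1 h2
        _ = -(1 / δ) + 2 * δ := by field_simp; ring
    have h_weaker : f ρ₁ + f ρ₂ + ((zetaZeroCount (γ - δ + 1) : ℝ) - zetaZeroCount (γ - δ - 1) - 2) * shift ≤
        -(1 / δ) + 2 * δ + ((zetaZeroCount (γ - δ + 1) : ℝ) - zetaZeroCount (γ - δ - 1)) * shift := by nlinarith [hpair_ub, hshift_pos]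
    rw [finsum_mem_eq_finite_toFinset_sum f hwin_m]; let S := hwin_m.toFinset
    have h₁S : ρ₁ ∈ S := by rw [Set.Finite.mem_toFinset]; exact hplus_in_wm
    have h₂S : ρ₂ ∈ S := by rw [Set.Finite.mem_toFinset]; exact hminus_in_wm
    have h₂S' : ρ₂ ∈ S.erase ρ₁ := Finset.mem_erase.mpr ⟨hne.symm, h₂S⟩
    have h_split : (S.erase ρ₁).sum f + f ρ₁ = S.sum f := Finset.sum_erase_add S f h₁S
    have h_split2 : ((S.erase ρ₁).erase ρ₂).sum f + f ρ₂ = (S.erase ρ₁).sum f := Finset.sum_erase_add (S.erase ρ₁) f h₂S'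
    have h_full_split : S.sum f = f ρ₁ + f ρ₂ + ((S.erase ρ₁).erase ρ₂).sum f := by rw [← h_split, ← h_split2]; ring
    let rest := (S.erase ρ₁).erase ρ₂; rw [h_full_split]
    have hS_eq : S = SchoenfeldBound.zerosBetween (γ - δ - 1) (γ - δ + 1) := by
      ext ρ; rw [Set.Finite.mem_toFinset]; simp only [SchoenfeldBound.zerosBetween, Set.Finite.mem_toFinset, window, Set.mem_sdiff]
    have hW_eq : (zetaZeroCount (γ - δ + 1) : ℝ) - zetaZeroCount (γ - δ - 1) = S.sum (fun ρ => (riemannZetaZeroOrder ρ : ℝ)) := by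
      rw [SchoenfeldBound.zetaZeroCount_sub_eq_sum (by linarith : γ - δ - 1 ≤ γ - δ + 1), ← hS_eq]
    have h_rest_ub : rest.sum f ≤ ((zetaZeroCount (γ - δ + 1) : ℝ) - zetaZeroCount (γ - δ - 1) - 2) * shift := by
      have hterm_bound : ∀ ρ ∈ rest, f ρ ≤ (riemannZetaZeroOrder ρ : ℝ) * shift := by
        intro ρ hρ
        have hρ_ne1 : ρ ≠ ρ₁ := Finset.ne_of_mem_erase (Finset.mem_erase.mp hρ).2
        have hρ_ne2 : ρ ≠ ρ₂ := fun h => (Finset.mem_erase.mp hρ).1 h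
        have hρ_in_win : ρ ∈ window (γ - δ) := by
          have h3 : ρ ∈ S := Finset.mem_of_mem_erase (Finset.mem_of_mem_erase hρ)
          rw [Set.Finite.mem_toFinset] at h3; exact h3
        simp only [window, Set.mem_sdiff, Set.mem_setOf_eq, zetaZeroBox] at hρ_in_win
        have hρ_zero := hρ_in_win.1.1; have hρ_im_pos : 0 < ρ.im := hρ_in_win.1.2.2.2.1
        have hρ_re0 := Literature.NumberTheory.DiophantineGeometry.re_pos_of_riemannZeta_eq_zero hρ_zero hρ_im_pos.ne'
        have hρ_re1 := Literature.NumberTheory.DiophantineGeometry.re_lt_one_of_riemannZeta_eq_zero hρ_zero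
        have hρ_iso : r ≤ |ρ.im - γ| := by
          by_contra h; push Not at h
          have hpair := hiso ρ hρ_zero hρ_re0 hρ_re1 h
          cases hpair.2 with
          | inl hre => exact hρ_ne1 (Complex.ext (by simp only [ρ₁, Complex.add_re, Complex.ofReal_re, Complex.mul_re, Complex.I_re, mul_zero, Complex.I_im, mul_one, hre]; norm_num) (by simp only [ρ₁, Complex.add_im, Complex.ofReal_im, Complex.mul_im, Complex.I_re, Complex.I_im, zero_mul, mul_one, add_zero, hpair.1]; norm_num))
          | inr hre => exact hρ_ne2 (Complex.ext (by simp only [ρ₂, Complex.sub_re, Complex.add_re, Complex.ofReal_re, Complex.mul_re, Complex.I_re, mul_zero, Complex.I_im, mul_one, hre]; norm_num) (by simp only [ρ₂, Complex.sub_im, Complex.add_im, Complex.ofReal_im, Complex.mul_im, Complex.I_re, Complex.I_im, zero_mul, mul_one, add_zero, hpair.1]; norm_num))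
        have ht_dist : |(γ - δ) - γ| ≤ δ := by simp [abs_neg, abs_of_pos hδ]
        have hker_bnd := abs_kernel_nonpair_le hδ h2δr hρ_iso hρ_re0 hρ_re1 ht_dist
        have hK_le : kernel (γ - δ) ρ ≤ shift := le_of_abs_le hker_bnd
        have hm_nonneg : 0 ≤ (riemannZetaZeroOrder ρ : ℝ) := by exact_mod_cast riemannZetaZeroOrder_nonneg_of_zero hρ_zero
        exact mul_le_mul_of_nonneg_left hK_le hm_nonneg
      have h_sum_pos : rest.sum f ≤ rest.sum (fun ρ => (riemannZetaZeroOrder ρ : ℝ) * shift) := Finset.sum_le_sum (fun ρ hρ => hterm_bound ρ hρ)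
      have h_factor : rest.sum (fun ρ => (riemannZetaZeroOrder ρ : ℝ) * shift) = shift * rest.sum (fun ρ => (riemannZetaZeroOrder ρ : ℝ)) := by
        have : ∀ ρ, (riemannZetaZeroOrder ρ : ℝ) * shift = shift * (riemannZetaZeroOrder ρ : ℝ) := by intro ρ; ring
        simp only [this, ← Finset.mul_sum]
      let m : ℂ → ℝ := fun ρ => (riemannZetaZeroOrder ρ : ℝ)
      have herase1 : m ρ₁ + (S.erase ρ₁).sum m = S.sum m := Finset.add_sum_erase S m h₁S
      have herase2 : m ρ₂ + rest.sum m = (S.erase ρ₁).sum m := Finset.add_sum_erase (S.erase ρ₁) m h₂S'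
      have hrest_mult_le : rest.sum m ≤ (zetaZeroCount (γ - δ + 1) : ℝ) - zetaZeroCount (γ - δ - 1) - 2 := by
        calc rest.sum m = S.sum m - m ρ₁ - m ρ₂ := by linarith [herase1, herase2]
          _ = (zetaZeroCount (γ - δ + 1) : ℝ) - zetaZeroCount (γ - δ - 1) - m ρ₁ - m ρ₂ := by rw [← hW_eq]
          _ ≤ _ := by simp only [m]; linarith [hord1, hord2]
      calc rest.sum f ≤ rest.sum (fun ρ => (riemannZetaZeroOrder ρ : ℝ) * shift) := h_sum_pos
        _ = shift * rest.sum m := h_factor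
        _ ≤ shift * ((zetaZeroCount (γ - δ + 1) : ℝ) - zetaZeroCount (γ - δ - 1) - 2) := mul_le_mul_of_nonneg_left hrest_mult_le (le_of_lt hshift_pos)
        _ = ((zetaZeroCount (γ - δ + 1) : ℝ) - zetaZeroCount (γ - δ - 1) - 2) * shift := by ring
    calc f ρ₁ + f ρ₂ + rest.sum f ≤ f ρ₁ + f ρ₂ + ((zetaZeroCount (γ - δ + 1) : ℝ) - zetaZeroCount (γ - δ - 1) - 2) * shift := by linarith [h_rest_ub]
      _ ≤ -(1 / δ) + 2 * δ + ((zetaZeroCount (γ - δ + 1) : ℝ) - zetaZeroCount (γ - δ - 1)) * shift := h_weaker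

end
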